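import Summits.Ventures.PercRepro.SixFourResidueThreeGenericCert
import Summits.Ventures.PercRepro.SixFourResidueGeneric

/-!
# PercRepro — C-025 at `(6,4)`: `J₃ ≥ 0` for GENERIC solids with `7 ≤ g ≤ 9` (p2, gen 9 — §21.18.2 (b), Theorem G₃ at small `g`)

The (α) generic half of the `t = 3` clause of `SixFourResidue` for `g ≤ 9`: the `J₃` identity
`J₃ = F₃(g) − Σ_ρ cost₃_g(ρ) + Σ_ℓ bonus₃(m_ℓ) + lpp − (6/5)·X₂` (`J_three_identity`) with `X₂ = 0` on a generic solid
(`X2cnt_eq_zero_of_generic`: a rank-`≤ 2` set `Z` with `r(G ∖ Z) ≤ 3` would put `G ∖ P ⊆ Z` for a plane `P ⊇ G ∖ Z`),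
the per-plane certificate of `SixFourResidueThreeGenericCert.lean` summed over the rank-`3` planes (every plane trace
of a generic solid has `p + 3 ≤ g`), §22.3 (`sum_inc_mul_eq`) and §22.2 (`lpp_ge`, `sum_eps_choose_le`), exactly as
p3's `J_four_nonneg_of_generic` / p2's `J_four_nonneg_of_generic_small` at `t = 4`.  Two small-`g` facts replace the
`t = 4` nonnegativity of the line bonus: in a generic solid with `g ≤ 9` every line has `≤ 6` points
(`inc_eq_zero_of_generic_small`), so the line sums ARE the profile sums over `m = 2..6`
(`sum_lines_eq_sum_Icc_of_generic_small`).
Main result: `J_three_nonneg_of_generic_small : 7 ≤ g ≤ 9 → Generic M G → 0 ≤ J₃(G)`.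
-/

namespace PercRepro.SixFour

open Finset ThmH

variable {α : Type*} [DecidableEq α] {M : Matroid α} [M.Finite] {G : Finset α}

/-! ## Generic solids have `X₂ = 0` and no line with `≥ 7` points (when `g ≤ 9`) -/

/-- **A generic solid has `X₂ = 0`**: if `Z ⊆ G` has rank `≤ 2` and `G ∖ Z` rank `≤ 3`, then `G ∖ Z` lies in a plane
`P`, so `G ∖ P ⊆ Z` has rank `≤ 2` — against genericity. -/
theorem X2cnt_eq_zero_of_generic (hG : G ⊆ gr M) (hr : M.eRk (G : Set α) = 4) (hgen : Generic M G) :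
    X2cnt M G = 0 := by
  unfold X2cnt
  rw [Finset.card_eq_zero, Finset.filter_eq_empty_iff]
  intro Z hZ hZZ
  obtain ⟨hZ2, hZ3⟩ := hZZ
  obtain ⟨P, hP, hsub⟩ := exists_plane_superset hG hr (Finset.sdiff_subset (s := G) (t := Z)) hZ3
  have h1 : G \ P ⊆ Z := by
    intro x hx
    rw [Finset.mem_sdiff] at hx
    by_contra hxZ
    exact hx.2 (hsub (Finset.mem_sdiff.2 ⟨hx.1, hxZ⟩))
  have h2 : M.eRk ((G \ P : Finset α) : Set α) ≤ 2 := (M.eRk_mono (Finset.coe_subset.2 h1)).trans hZ2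
  have h3 : (3 : ℕ∞) ≤ 2 := (hgen P hP).trans h2
  have h3' : (3 : ℕ) ≤ 2 := by exact_mod_cast h3
  omega

/-- In a generic solid with `g ≤ 9` no line meets `G` in `≥ 7` points (a plane through it would have `≥ 7 > g − 3`
points of `G`). -/
theorem inc_eq_zero_of_generic_small (hG : G ⊆ gr M) (hr : M.eRk (G : Set α) = 4) (hgen : Generic M G)
    (hg' : G.card ≤ 9) {m : ℕ} (hm : 7 ≤ m) : inc M G m = 0 := by
  unfold inc
  rw [Finset.card_eq_zero, Finset.filter_eq_empty_iff]
  intro L hL hc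
  have hr2 : M.eRk ((L ∩ G : Finset α) : Set α) ≤ 3 := by
    have h2 : M.eRk ((L ∩ G : Finset α) : Set α) ≤ 2 :=
      (M.eRk_mono (Finset.coe_subset.2 (Finset.inter_subset_left (s₁ := L) (s₂ := G)))).trans_eq (mem_lines.1 hL).2.2
    exact h2.trans (by exact_mod_cast (by norm_num : (2 : ℕ) ≤ 3))
  obtain ⟨P, hP, hsub⟩ := exists_plane_superset hG hr (Finset.inter_subset_right (s₁ := L) (s₂ := G)) hr2
  have h1 := card_trace_add_three_le_of_generic hgen hP
  have h2 : (L ∩ G).card ≤ (P ∩ G).card :=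
    Finset.card_le_card (fun x hx => Finset.mem_inter.2 ⟨hsub hx, (Finset.mem_inter.1 hx).2⟩)
  omega

/-- For a generic solid with `g ≤ 9`, a sum over the lines of `f(|ℓ ∩ G|)` with `f 0 = f 1 = 0` is the profile sum
over `m = 2..6`. -/
theorem sum_lines_eq_sum_Icc_of_generic_small (hG : G ⊆ gr M) (hr : M.eRk (G : Set α) = 4) (hgen : Generic M G)
    (hg6 : 6 ≤ G.card) (hg' : G.card ≤ 9) (f : ℕ → ℚ) (hf0 : f 0 = 0) (hf1 : f 1 = 0) :
    ∑ L ∈ lines M, f (L ∩ G).card = ∑ m ∈ Finset.Icc 2 6, (inc M G m : ℚ) * f m := by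
  rw [sum_lines_eq_sum_inc_rat]
  symm
  apply Finset.sum_subset
  · intro m hm
    rw [Finset.mem_Icc] at hm
    rw [Finset.mem_range]
    omega
  · intro m hm hm'
    rw [Finset.mem_range] at hm
    rw [Finset.mem_Icc] at hm'
    rcases Nat.lt_or_ge m 2 with h | h
    · interval_cases m
      · rw [hf0, mul_zero]
      · rw [hf1, mul_zero]
    · have h7 : 7 ≤ m := by omega
      rw [inc_eq_zero_of_generic_small hG hr hgen hg' h7]
      simp

/-! ## The `t = 3` cost vanishes off the rank-`3` planes -/

/-- `Σ_{P ∈ planes M} cost₃ ≤ Σ_{P : r(P ∩ G) = 3} cost₃` (the other planes have `D₃ = r₃₄ = 0`). -/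
theorem sum_cost3_le_filter (G : Finset α) :
    ∑ P ∈ planes M, cost3 M G P ≤
      ∑ P ∈ (planes M).filter (fun P : Finset α => M.eRk ((P ∩ G : Finset α) : Set α) = 3), cost3 M G P := by
  rw [← Finset.sum_filter_add_sum_filter_not (planes M)
    (fun P : Finset α => M.eRk ((P ∩ G : Finset α) : Set α) = 3) (fun P => cost3 M G P)]
  have h0 : ∑ P ∈ (planes M).filter (fun P : Finset α => ¬ M.eRk ((P ∩ G : Finset α) : Set α) = 3), cost3 M G P = 0 := by
    refine Finset.sum_eq_zero (fun P hP => ?_)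
    obtain ⟨hP, hne⟩ := Finset.mem_filter.1 hP
    obtain ⟨h1, h2⟩ := D3_r34_eq_zero_of_ne hP hne
    unfold cost3
    rw [h1, h2]
    simp
  rw [h0, add_zero]

/-! ## The certificate summed over the planes, with the small-`g` `t = 3` prices -/

/-- One term of the right side of the `t = 3` certificate: `y₃_m·inc_m·(p − m)`. -/
noncomputable def certTermS3 (M : Matroid α) [M.Finite] (G P : Finset α) (g m : ℕ) : ℚ :=
  yPriceS3 g m * (inc M (P ∩ G) m : ℚ) * (((P ∩ G).card - m : ℕ) : ℚ)

/-- The right side of the `t = 3` certificate for the plane `P`. -/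
noncomputable def certRHSS3 (M : Matroid α) [M.Finite] (G P : Finset α) (g : ℕ) : ℚ :=
  certTermS3 M G P g 2 + certTermS3 M G P g 3 + certTermS3 M G P g 4 + certTermS3 M G P g 5 + certTermS3 M G P g 6

/-- The `t = 3` certificate for a rank-`3` plane trace with `p + 3 ≤ g`, in the plane vocabulary:
`cost₃_g(P) + lppCredit(P) ≤ certRHSS3`. -/
theorem cert_plane_S3 (hs : Simple M) (hG : G ⊆ gr M) (hg : 7 ≤ G.card) (hg' : G.card ≤ 9) {P : Finset α}
    (hp : (P ∩ G).card + 3 ≤ G.card) (hr : M.eRk ((P ∩ G : Finset α) : Set α) = 3) :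
    cost3 M G P + (lppCredit M G P : ℚ) ≤ certRHSS3 M G P G.card := by
  have h7 : (P ∩ G).card ≤ 7 := by omega
  have hc := certQ3_of_trace_S hs hG hg hg' hp hr
  unfold CertQS3 at hc
  rw [← D3_eq_D3Prof hs hG h7 hr, ← r34_eq_r34Prof hs hG h7 hr, ← sum_eps_eq_lppProf hr h7] at hc
  unfold cost3 certRHSS3 certTermS3 lppCredit
  linarith

/-- The right side is nonnegative. -/
theorem certRHSS3_nonneg (G P : Finset α) {g : ℕ} (hg : 7 ≤ g) (hg' : g ≤ 9) : 0 ≤ certRHSS3 M G P g := by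
  unfold certRHSS3 certTermS3
  have := yPriceS3_nonneg hg hg'
  have h2 := this 2
  have h3 := this 3
  have h4 := this 4
  have h5 := this 5
  have h6 := this 6
  positivity

/-- `Σ_{P} certTermS3 m = y₃_m·(g − m)·b_m` (§22.3) for `2 ≤ m`. -/
theorem sum_certTermS3_eq (hs : Simple M) (hG : G ⊆ gr M) (g : ℕ) {m : ℕ} (hm : 2 ≤ m) :
    ∑ P ∈ planes M, certTermS3 M G P g m = yPriceS3 g m * ((G.card - m : ℕ) : ℚ) * (bLines M G m : ℚ) := by
  unfold certTermS3
  have h := sum_inc_mul_eq hs hG (m := m) hm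
  have h' : ∑ P ∈ planes M, ((inc M (P ∩ G) m * ((P ∩ G).card - m) : ℕ) : ℚ) =
      ((G.card - m : ℕ) : ℚ) * (bLines M G m : ℚ) := by
    rw [← Nat.cast_sum, h, Nat.cast_mul]
  rw [mul_assoc, ← h', Finset.mul_sum]
  refine Finset.sum_congr rfl (fun P _ => ?_)
  push_cast
  ring

/-! ## Theorem G₃ at `g = 7, 8, 9` -/

/-- **The (α) generic half of the `t = 3` clause for `g ≤ 9` (§21.18.2 (b), Theorem G₃ at small `g`)**: for a generic
rank-`4` set `G ⊆ E` of a simple matroid with `7 ≤ g ≤ 9` points, `0 ≤ J₃(G)`. -/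
theorem J_three_nonneg_of_generic_small (hs : Simple M) (hG : G ⊆ gr M) (hr : M.eRk (G : Set α) = 4)
    (hgen : Generic M G) (hg : 7 ≤ G.card) (hg' : G.card ≤ 9) : 0 ≤ J M G 3 := by
  set S := (planes M).filter (fun P : Finset α => M.eRk ((P ∩ G : Finset α) : Set α) = 3) with hS
  have hg6 : 6 ≤ G.card := by omega
  -- F1: the identity, with `X₂ = 0`
  have F1 := J_three_identity hs hG hr
  have hX : X2cnt M G = 0 := X2cnt_eq_zero_of_generic hG hr hgen
  -- F2: the cost sum restricted to the rank-`3` planes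
  have F2 := sum_cost3_le_filter (M := M) G
  -- F3: the certificate summed over `S`
  have F3 : ∑ P ∈ S, cost3 M G P + ∑ P ∈ S, (lppCredit M G P : ℚ) ≤ ∑ P ∈ S, certRHSS3 M G P G.card := by
    rw [← Finset.sum_add_distrib]
    refine Finset.sum_le_sum (fun P hP => ?_)
    obtain ⟨hP, hr3⟩ := Finset.mem_filter.1 hP
    exact cert_plane_S3 hs hG hg hg' (card_trace_add_three_le_of_generic hgen hP) hr3
  -- F4: extend the right side to all planes
  have F4 : ∑ P ∈ S, certRHSS3 M G P G.card ≤ ∑ P ∈ planes M, certRHSS3 M G P G.card :=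
    Finset.sum_le_sum_of_subset_of_nonneg (Finset.filter_subset _ _) (fun P _ _ => certRHSS3_nonneg G P hg hg')
  -- F5 + F6: the right side as the line quantities, with the price identities
  have F56 : ∑ P ∈ planes M, certRHSS3 M G P G.card =
      yPS3 G.card * ∑ m ∈ Finset.Icc 2 6, (inc M G m : ℚ) * (m.choose 2 : ℚ) +
      ∑ m ∈ Finset.Icc 2 6, (inc M G m : ℚ) * bonus3 m +
      ∑ m ∈ Finset.Icc 2 6, (inc M G m : ℚ) * ((eps m : ℚ) * ((G.card - m).choose 2 : ℚ)) := by
    unfold certRHSS3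
    simp only [Finset.sum_add_distrib]
    rw [sum_certTermS3_eq hs hG _ (by norm_num), sum_certTermS3_eq hs hG _ (by norm_num),
      sum_certTermS3_eq hs hG _ (by norm_num), sum_certTermS3_eq hs hG _ (by norm_num),
      sum_certTermS3_eq hs hG _ (by norm_num)]
    rw [price_identity_S3 hg hg' (by norm_num) (by norm_num), price_identity_S3 hg hg' (by norm_num) (by norm_num),
      price_identity_S3 hg hg' (by norm_num) (by norm_num), price_identity_S3 hg hg' (by norm_num) (by norm_num),
      price_identity_S3 hg hg' (by norm_num) (by norm_num)]
    rw [show Finset.Icc 2 6 = {2, 3, 4, 5, 6} from rfl]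
    simp only [Finset.sum_insert (by decide : (2 : ℕ) ∉ ({3, 4, 5, 6} : Finset ℕ)),
      Finset.sum_insert (by decide : (3 : ℕ) ∉ ({4, 5, 6} : Finset ℕ)),
      Finset.sum_insert (by decide : (4 : ℕ) ∉ ({5, 6} : Finset ℕ)),
      Finset.sum_insert (by decide : (5 : ℕ) ∉ ({6} : Finset ℕ)), Finset.sum_singleton]
    unfold bLines
    ring
  -- F7: the line-side identities
  have F7a : ∑ m ∈ Finset.Icc 2 6, (inc M G m : ℚ) * (m.choose 2 : ℚ) ≤ (G.card.choose 2 : ℚ) := by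
    have := sum_Icc_choose_two_le hs hG hg6
    have h' : ∑ m ∈ Finset.Icc 2 6, (inc M G m : ℚ) * (m.choose 2 : ℚ) =
        ((∑ m ∈ Finset.Icc 2 6, inc M G m * m.choose 2 : ℕ) : ℚ) := by push_cast; rfl
    rw [h']
    exact_mod_cast this
  have F7b : ∑ m ∈ Finset.Icc 2 6, (inc M G m : ℚ) * bonus3 m = ∑ L ∈ lines M, bonus3 (L ∩ G).card :=
    (sum_lines_eq_sum_Icc_of_generic_small hG hr hgen hg6 hg' bonus3 (by simp [bonus3, eps, delta])
      (by simp [bonus3, eps, delta])).symm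
  have F7c : ∑ m ∈ Finset.Icc 2 6, (inc M G m : ℚ) * ((eps m : ℚ) * ((G.card - m).choose 2 : ℚ)) =
      ∑ L ∈ lines M, ((eps (L ∩ G).card : ℚ) * ((G.card - (L ∩ G).card).choose 2 : ℚ)) :=
    (sum_lines_eq_sum_Icc_of_generic_small hG hr hgen hg6 hg'
      (fun m => (eps m : ℚ) * ((G.card - m).choose 2 : ℚ)) (by simp [eps]) (by simp [eps])).symm
  -- F9: the `lpp` lower bound
  have F9 : ∑ L ∈ lines M, ((eps (L ∩ G).card : ℚ) * ((crossPairs M G L).card : ℚ)) ≤ (lpp M G : ℚ) := by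
    have := lpp_ge hs hG
    have h' : ∑ L ∈ lines M, ((eps (L ∩ G).card : ℚ) * ((crossPairs M G L).card : ℚ)) =
        ((∑ L ∈ lines M, eps (L ∩ G).card * (crossPairs M G L).card : ℕ) : ℚ) := by push_cast; rfl
    rw [h']
    exact_mod_cast this
  -- F10: the lpp credit
  have F10 : ∑ L ∈ lines M, ((eps (L ∩ G).card : ℚ) * ((G.card - (L ∩ G).card).choose 2 : ℚ)) ≤
      ∑ L ∈ lines M, ((eps (L ∩ G).card : ℚ) * ((crossPairs M G L).card : ℚ)) + ∑ P ∈ S, (lppCredit M G P : ℚ) := by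
    have := sum_eps_choose_le hs hG
    rw [← hS] at this
    have h1 : ∑ L ∈ lines M, ((eps (L ∩ G).card : ℚ) * ((G.card - (L ∩ G).card).choose 2 : ℚ)) =
        ((∑ L ∈ lines M, eps (L ∩ G).card * (G.card - (L ∩ G).card).choose 2 : ℕ) : ℚ) := by push_cast; rfl
    have h2 : ∑ L ∈ lines M, ((eps (L ∩ G).card : ℚ) * ((crossPairs M G L).card : ℚ)) =
        ((∑ L ∈ lines M, eps (L ∩ G).card * (crossPairs M G L).card : ℕ) : ℚ) := by push_cast; rfl
    have h3 : ∑ P ∈ S, (lppCredit M G P : ℚ) = ((∑ P ∈ S, lppCredit M G P : ℕ) : ℚ) := by push_cast; rfl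
    rw [h1, h2, h3, ← Nat.cast_add]
    exact_mod_cast this
  -- F11: `F₃(g) = y₃_P·C(g,2)`, and `y₃_P ≥ 0`
  have F11 := F3_eq_yPS3 hg hg'
  have hyP : 0 ≤ yPS3 G.card := yPS3_nonneg _
  -- assemble
  have hyPC : yPS3 G.card * ∑ m ∈ Finset.Icc 2 6, (inc M G m : ℚ) * (m.choose 2 : ℚ) ≤
      yPS3 G.card * (G.card.choose 2 : ℚ) :=
    mul_le_mul_of_nonneg_left F7a hyP
  rw [F1, hX]
  push_cast
  linarith [F2, F3, F4, F56, F7b, F7c, F9, F10, F11, hyPC]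

end PercRepro.SixFour
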